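import Mathlib
import HarnessLib
import Literature.MathematicalPhysics.QuantumLattice.KohnLuttinger
import Literature.MathematicalPhysics.QuantumLattice.KohnLuttingerFermiCurvePolarIntegral
import Summits.HubbardSuperconductivity.HubbardSuperconductivity.Theorems.WeakCouplingBCSWcbcsKohnLuttingerB1gMuWindow
import Summits.HubbardSuperconductivity.HubbardSuperconductivity.Theorems.ChiralWindowCwKLChiralWindowKernelHS
import Summits.HubbardSuperconductivity.HubbardSuperconductivity.Theorems.ChiralWindowCwKLChiralWindowFrameHS

/-!
# Route `WeakCouplingBCS` — support item `WcbcsKohnLuttingerB1g` (stmt-HubbardSuperconductivity-0158):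
# the item from the THREE NUMERICAL deliverables alone

`wcbcsKohnLuttingerB1g_of_numerical_certificate`: for a chemical-potential window
`-4 < μ₂ < μ₁ < 0` and a margin `γ > 0`, the route item `WcbcsKohnLuttingerB1g` holds verbatim as
soon as, uniformly in `μ ∈ [μ₂, μ₁]` (`σ = fermiCurveMeasure ε μ`, `χ₀ = lindhardFunction ε μ`,
`Q(ψ) = ∫ ψ(k) (∫ χ₀(k+k') ψ(k') dσ) dσ`, `ε = squareDispersion 1 0`):

* (iii) `Λ μ χ ≤ Q(ψ)` for every normalised state `ψ` of every channel `χ` (per-channel lower bounds);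
* (iv) some normalised `B1g` state with `∫ψ dσ = 0` has `Q(ψ) ≤ ΛB μ` (witness);
* (v) `ΛB μ + γ ≤ Λ μ χ ≤ 0` for `χ ≠ B1g` (the certified gap).

Compared with `wcbcsKohnLuttingerB1g_of_mu_certificate` the analytic hypotheses are gone: the
finiteness of `σ` is `Literature…isFiniteMeasure_fermiCurveMeasure` (polar picture) and the
boundedness hypothesis on `χ₀` is replaced by the Hilbert–Schmidt property
`χ₀(k+k') ∈ L²(σ ⊗ σ)` proved unconditionally on `(-4,0)` by the `ChiralWindow` crux line
(`stub_klKernelHS`), through their splitting `klhs_frame_pairingForm_split`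
`⟨ψ, Γ_U ψ⟩ = U(∫ψ dσ)² + U² Q(ψ)`. What remains is exactly the interval-arithmetic certificate.

References: S. Raghu, S. A. Kivelson, D. J. Scalapino, Phys. Rev. B 81 (2010) 224505, §II (7), §III Fig. 2.
-/

noncomputable section

-- the tree's namespace `Summit.<Summit>.<Problem>.Theorems` repeats the summit name by design (D-0017)
set_option linter.dupNamespace false

namespace Summit.HubbardSuperconductivity.HubbardSuperconductivity.Theorems

open MeasureTheory Literature.MathematicalPhysics.QuantumLattice Real

variable {ε : Momentum → ℝ} {μ : ℝ}

/-- **Lower bound from a Hilbert–Schmidt kernel.** If `σ` is finite, `χ₀(k+k') ∈ L²(σ ⊗ σ)`, and the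
Lindhard form is `≥ Λ` on the normalised states of a channel with `Λ ≤ 0`, then `U² Λ ≤ channelInf`
for `U ≥ 0` (the first-order term `U(∫ψ)²` is non-negative; an empty admissible set gives the junk
value `0 ≥ U² Λ`). [cite: RaghuKivelsonScalapino2010, §II (7) and (13)] -/
theorem sq_mul_le_channelInf_of_hs {U Λ : ℝ} (hU : 0 ≤ U) (χ : D4Irrep)
    (hfin : IsFiniteMeasure (fermiCurveMeasure ε μ))
    (hK : MemLp (fun z : Momentum × Momentum => lindhardFunction ε μ (z.1 + z.2)) 2
      ((fermiCurveMeasure ε μ).prod (fermiCurveMeasure ε μ)))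
    (hΛ : Λ ≤ 0)
    (hlow : ∀ ψ, IsChannelState ε μ χ ψ →
      Λ ≤ ∫ k, ψ k * ∫ k', lindhardFunction ε μ (k + k') * ψ k' ∂fermiCurveMeasure ε μ
        ∂fermiCurveMeasure ε μ) :
    U ^ 2 * Λ ≤ channelInf ε μ U χ := by
  unfold channelInf
  set S := pairingForm ε μ U '' {ψ | IsChannelState ε μ χ ψ} with hS
  rcases S.eq_empty_or_nonempty with hSe | hSne
  · rw [hSe, Real.sInf_empty]
    exact mul_nonpos_of_nonneg_of_nonpos (sq_nonneg U) hΛ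
  · refine le_csInf hSne ?_
    rintro x ⟨ψ, hψ, rfl⟩
    rw [klhs_frame_pairingForm_split U hK hψ.1]
    have h1 : 0 ≤ U * (∫ k, ψ k ∂fermiCurveMeasure ε μ) ^ 2 := mul_nonneg hU (sq_nonneg _)
    have h2 : U ^ 2 * Λ ≤ U ^ 2 * ∫ k, ψ k * ∫ k', lindhardFunction ε μ (k + k') * ψ k'
        ∂fermiCurveMeasure ε μ ∂fermiCurveMeasure ε μ :=
      mul_le_mul_of_nonneg_left (hlow ψ hψ) (sq_nonneg U)
    linarith

/-- **Upper bound from a Hilbert–Schmidt kernel.** A normalised channel state with `∫ψ dσ = 0` and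
Lindhard form `≤ Λ'` gives `channelInf ≤ U² Λ'` (the admissible set is bounded below by `hlow`).
[cite: RaghuKivelsonScalapino2010, §II (7) and (13)] -/
theorem channelInf_le_sq_mul_of_hs {U Λ Λ' : ℝ} (hU : 0 ≤ U) (χ : D4Irrep)
    (hfin : IsFiniteMeasure (fermiCurveMeasure ε μ))
    (hK : MemLp (fun z : Momentum × Momentum => lindhardFunction ε μ (z.1 + z.2)) 2
      ((fermiCurveMeasure ε μ).prod (fermiCurveMeasure ε μ)))
    (hlow : ∀ ψ, IsChannelState ε μ χ ψ →
      Λ ≤ ∫ k, ψ k * ∫ k', lindhardFunction ε μ (k + k') * ψ k' ∂fermiCurveMeasure ε μ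
        ∂fermiCurveMeasure ε μ)
    (hwit : ∃ ψ, IsChannelState ε μ χ ψ ∧ ∫ k, ψ k ∂fermiCurveMeasure ε μ = 0 ∧
      ∫ k, ψ k * ∫ k', lindhardFunction ε μ (k + k') * ψ k' ∂fermiCurveMeasure ε μ
        ∂fermiCurveMeasure ε μ ≤ Λ') :
    channelInf ε μ U χ ≤ U ^ 2 * Λ' := by
  obtain ⟨ψ, hψ, hmean, hQ⟩ := hwit
  unfold channelInf
  have hbb : BddBelow (pairingForm ε μ U '' {ψ | IsChannelState ε μ χ ψ}) := by
    refine ⟨U ^ 2 * Λ, ?_⟩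
    rintro x ⟨φ, hφ, rfl⟩
    rw [klhs_frame_pairingForm_split U hK hφ.1]
    have h1 : 0 ≤ U * (∫ k, φ k ∂fermiCurveMeasure ε μ) ^ 2 := mul_nonneg hU (sq_nonneg _)
    have h2 : U ^ 2 * Λ ≤ U ^ 2 * ∫ k, φ k * ∫ k', lindhardFunction ε μ (k + k') * φ k'
        ∂fermiCurveMeasure ε μ ∂fermiCurveMeasure ε μ :=
      mul_le_mul_of_nonneg_left (hlow φ hφ) (sq_nonneg U)
    linarith
  calc sInf (pairingForm ε μ U '' {ψ | IsChannelState ε μ χ ψ})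
      ≤ pairingForm ε μ U ψ := csInf_le hbb ⟨ψ, hψ, rfl⟩
    _ = U * (∫ k, ψ k ∂fermiCurveMeasure ε μ) ^ 2 +
          U ^ 2 * ∫ k, ψ k * ∫ k', lindhardFunction ε μ (k + k') * ψ k' ∂fermiCurveMeasure ε μ
            ∂fermiCurveMeasure ε μ := klhs_frame_pairingForm_split U hK hψ.1
    _ ≤ U ^ 2 * Λ' := by
          rw [hmean]
          have := mul_le_mul_of_nonneg_left hQ (sq_nonneg U)
          linarith

/-- **`WcbcsKohnLuttingerB1g` from the three numerical deliverables.** Let `-4 < μ₂ < μ₁ < 0` and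
`γ > 0`, and suppose that for every `μ ∈ [μ₂, μ₁]`: (iii) `Λ μ χ ≤ Q(ψ)` for every normalised state of
every channel; (iv) a normalised mean-zero `B1g` state has `Q ≤ ΛB μ`; (v) `ΛB μ + γ ≤ Λ μ χ ≤ 0` for
`χ ≠ B1g`. Then the route item holds verbatim (doping window `[1 - n(μ₁), 1 - n(μ₂)]`, any `U₁ > 0`):
`channelInf(B1g) + γU² ≤ U² ΛB + γU² ≤ U² Λ χ ≤ channelInf(χ)`, the splitting of the pairing form being
unconditional (`stub_klKernelHS`, `klhs_frame_pairingForm_split`, `isFiniteMeasure_fermiCurveMeasure`,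
`chemicalPotentialOfDensity_window`). [cite: RaghuKivelsonScalapino2010, §III Fig. 2] -/
theorem wcbcsKohnLuttingerB1g_of_numerical_certificate {μ₁ μ₂ γ : ℝ} {ΛB : ℝ → ℝ} {Λ : ℝ → D4Irrep → ℝ}
    (h4 : -4 < μ₂) (h12 : μ₂ < μ₁) (h0 : μ₁ < 0) (hγ : 0 < γ)
    (hlow : ∀ μ ∈ Set.Icc μ₂ μ₁, ∀ χ : D4Irrep, ∀ ψ, IsChannelState (squareDispersion 1 0) μ χ ψ →
      Λ μ χ ≤ ∫ k, ψ k * ∫ k', lindhardFunction (squareDispersion 1 0) μ (k + k') * ψ k'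
        ∂fermiCurveMeasure (squareDispersion 1 0) μ ∂fermiCurveMeasure (squareDispersion 1 0) μ)
    (hwit : ∀ μ ∈ Set.Icc μ₂ μ₁, ∃ ψ, IsChannelState (squareDispersion 1 0) μ D4Irrep.B1g ψ ∧
      ∫ k, ψ k ∂fermiCurveMeasure (squareDispersion 1 0) μ = 0 ∧
      ∫ k, ψ k * ∫ k', lindhardFunction (squareDispersion 1 0) μ (k + k') * ψ k'
        ∂fermiCurveMeasure (squareDispersion 1 0) μ ∂fermiCurveMeasure (squareDispersion 1 0) μ ≤ ΛB μ)
    (hgap : ∀ μ ∈ Set.Icc μ₂ μ₁, ∀ χ : D4Irrep, χ ≠ D4Irrep.B1g → ΛB μ + γ ≤ Λ μ χ)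
    (hΛ : ∀ μ ∈ Set.Icc μ₂ μ₁, ∀ χ : D4Irrep, χ ≠ D4Irrep.B1g → Λ μ χ ≤ 0) :
    ∃ a b γ U₁ : ℝ, 0 < a ∧ a < b ∧ b < 1 ∧ 0 < γ ∧ 0 < U₁ ∧ ∀ δ ∈ Set.Icc a b,
      ∀ U ∈ Set.Ioo (0:ℝ) U₁, ∀ χ : Literature.MathematicalPhysics.QuantumLattice.D4Irrep,
        χ ≠ Literature.MathematicalPhysics.QuantumLattice.D4Irrep.B1g →
          Literature.MathematicalPhysics.QuantumLattice.channelInf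
              (Literature.MathematicalPhysics.QuantumLattice.squareDispersion 1 0)
              (Literature.MathematicalPhysics.QuantumLattice.chemicalPotentialOfDensity
                (Literature.MathematicalPhysics.QuantumLattice.squareDispersion 1 0) (1 - δ)) U
              Literature.MathematicalPhysics.QuantumLattice.D4Irrep.B1g + γ * U ^ 2 ≤
            Literature.MathematicalPhysics.QuantumLattice.channelInf
              (Literature.MathematicalPhysics.QuantumLattice.squareDispersion 1 0)
              (Literature.MathematicalPhysics.QuantumLattice.chemicalPotentialOfDensity
                (Literature.MathematicalPhysics.QuantumLattice.squareDispersion 1 0) (1 - δ)) U χ := by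
  obtain ⟨ha, hab, hb, hwin⟩ := chemicalPotentialOfDensity_window h4 h12 h0
  refine ⟨_, _, γ, 1, ha, hab, hb, hγ, one_pos, fun δ hδ U hU χ hχ => ?_⟩
  set m := chemicalPotentialOfDensity (squareDispersion 1 0) (1 - δ) with hm
  have hmI : m ∈ Set.Icc μ₂ μ₁ := hwin δ hδ
  have hm1 : -4 < m := lt_of_lt_of_le h4 hmI.1
  have hm2 : m < 0 := lt_of_le_of_lt hmI.2 h0
  have hfin : IsFiniteMeasure (fermiCurveMeasure (squareDispersion 1 0) m) :=
    Literature.MathematicalPhysics.QuantumLattice.isFiniteMeasure_fermiCurveMeasure hm1 hm2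
  have hK := stub_klKernelHS m ⟨hm1, hm2⟩
  have hU0 : 0 ≤ U := hU.1.le
  have hup := channelInf_le_sq_mul_of_hs hU0 D4Irrep.B1g hfin hK (hlow m hmI D4Irrep.B1g) (hwit m hmI)
  have hdown := sq_mul_le_channelInf_of_hs hU0 χ hfin hK (hΛ m hmI χ hχ) (hlow m hmI χ)
  have hg := mul_le_mul_of_nonneg_left (hgap m hmI χ hχ) (sq_nonneg U)
  nlinarith [hup, hdown, hg]

end Summit.HubbardSuperconductivity.HubbardSuperconductivity.Theorems

end
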